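/-
Copyright (c) 2026. All rights reserved.
Released under Apache 2.0 license as described in the file LICENSE.
Authors: HodgeCM publication cell (pub-hodgecm), GR lane, seat GR-2 (`pub-hodgecm-own-hyp34`).
-/
import Literature.NumberTheory.Weil1964.ArchFollandFrameGen
import Literature.NumberTheory.Weil1964.ArchMetaplecticLeviSection
import Literature.NumberTheory.Automorphic.UnitaryGroupArchComplexPair
import HarnessLib

/-!
# Realification at a complex place: `Sp_ℂ((ℂ^ι)², β_T) → Sp(ℝ^{ι ⊕ ι} × ℝ^{ι ⊕ ι})` in the complex Folland frame, and
# the complex Siegel Levi becomes the real Siegel Levi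

Topic `NumberTheory/Weil1964`; namespace `Literature.NumberTheory.Weil1964`.  KERNEL ONLY: definitions with bodies and
theorems; no `def … : Prop` record, no `axiom`, no proof hole.

At a complex place `v` of a number field `F` the `v`-slice of the archimedean phase space `W_∞` of an `F`-rational
symmetric Gram matrix `T` is `(ℂ^ι)²` with the COMPLEX symplectic form `B = polar β_{T_v}` (`T_v = σ_v T`), of which
the real symplectic form of `W_∞` is the trace `Tr_{ℂ/ℝ} B = 2 re B`; the complex slice of the scaled Folland frame
(`ArchFollandFrameGen.cxFollandScale C T_v`, `(a, w) ↦ (reImVec (C a), reImVec (-2 conj(T_v w / C)))`) is a Darboux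
frame for `-2 re B` (`polar_dotPairing_cxFollandScale`).  Hence:

* §1 the realification `resMat M = [[re M, -im M], [im M, re M]]` of a complex matrix on `ι ⊕ ι`
  (`reImVec (M z) = resMat M · reImVec z`), a ring homomorphism with `resMat Mᴴ = (resMat M)ᵀ`, and
  `resGL : GL_ι(ℂ) →* GL_{ι ⊕ ι}(ℝ)`;
* §2 the frame as a real-linear isomorphism `cxFrameEquiv C T_v : (ℂ^ι)² ≃ₗ[ℝ] (ℝ^{ι⊕ι})²` and
  **`cxRealify C T_v : Sp_ℂ((ℂ^ι)², polar β_{T_v}) →* Sp((ℝ^{ι⊕ι})², polar dotPairing)`**, `M ↦ R_C ∘ M ∘ R_C⁻¹`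
  (`cxRealify_apply_cxFollandScale`);
* §3 **the complex Siegel Levi realifies to the real Siegel Levi** (`C = 1`): 
  `cxRealify 1 T_v (m(g₊, T_v⁻¹ g₊⁻ᵀ T_v)) = m(Res g₊, (Res g₊)⁻ᵀ)` (`cxRealify_leviSp`), where the right side is the
  projection of the Levi element `MpS.leviGL (resGL g₊)` of `ArchMetaplecticLeviSection` — the input of
  `MpS.leviAlong`; with `UnitaryGroupSymplecticSplitLevi.splitCayley_conj_toSymplectic` this reads the image of a
  unitary group `U(swap, T_v ⊗ 1)(ℂ × ℂ)` (the `(w, cw)`-factor at a complex place, `UnitaryGroupArchComplexPair`)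
  as the conjugate by `κ = cxRealify (splitCayley)` of the real Siegel Levi `g ↦ m(Res g_w)`
  (`cxRealify_toSymplectic`).

Dictionary with print: [MoeglinVignerasWaldspurger1987, Chap. 1 I.17–I.19, Chap. 2 II.2]: at a place where the
quadratic algebra splits the unitary group is a general linear group sitting in the symplectic group of the doubled
space as the Levi of a Siegel parabolic (up to conjugation); [Folland1989, §4.2 (4.24)]: the metaplectic
representation restricted to that Levi is `|det A|^{-1/2} f(A⁻¹ x)`, an honest representation; realification of
`GL_n(ℂ) ⊂ GL_{2n}(ℝ)` [Folland1989, Ch. 4 §1 Prop. (4.6)].  Pure linear algebra; no analysis, no number field.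

## References
* [MoeglinVignerasWaldspurger1987] C. Mœglin, M.-F. Vignéras, J.-L. Waldspurger, LNM 1291 (1987), Chap. 1 I.17–I.19,
  Chap. 2 II.2.
* [Folland1989] G. B. Folland, *Harmonic Analysis in Phase Space*, Princeton UP (1989), Ch. 4 §1 Prop. (4.6),
  §4.2 (4.24).
* [Kudla1994] S. S. Kudla, Israel J. Math. 87 (1994), §3.
-/

set_option autoImplicit false

noncomputable section

open scoped Matrix ComplexConjugate
open Complex Matrix
open Literature.RepresentationTheory.HeisenbergGroup
open Literature.RepresentationTheory.HeisenbergGroup.SymplecticMatrix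
open Literature.Analysis.SegalBargmann
open Literature.NumberTheory.Automorphic Literature.NumberTheory.Automorphic.UnitaryGroup

namespace Literature.NumberTheory.Weil1964

variable {ι : Type} [Fintype ι] [DecidableEq ι]

/-! ## §1 Realification of complex matrices on `ι ⊕ ι` -/

section Res

variable (ι) in
/-- **`resMat M = [[re M, -im M], [im M, re M]]`**: the matrix of `z ↦ M z` on `ℂ^ι = ℝ^ι ⊕ i ℝ^ι` in the
coordinates `reImVec`. [cite: Folland1989, Ch. 4 §1 Prop. (4.6)] -/
def resMat (M : Matrix ι ι ℂ) : Matrix (ι ⊕ ι) (ι ⊕ ι) ℝ :=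
  Matrix.fromBlocks (M.map Complex.re) (-M.map Complex.im) (M.map Complex.im) (M.map Complex.re)

omit [DecidableEq ι] in
/-- **`reImVec (M z) = resMat M · reImVec z`.** [cite: Folland1989, Ch. 4 §1 Prop. (4.6)] -/
theorem reImVec_mulVec (M : Matrix ι ι ℂ) (z : ι → ℂ) : reImVec ι (M *ᵥ z) = resMat ι M *ᵥ reImVec ι z := by
  have hz : reImVec ι z = Sum.elim (fun j => (z j).re) (fun j => (z j).im) := rfl
  rw [hz, resMat, Matrix.fromBlocks_mulVec]
  funext k
  rcases k with j | j
  · simp only [reImVec_inl, Sum.elim_inl, Matrix.mulVec, dotProduct, Complex.re_sum, Complex.mul_re, Pi.add_apply,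
      Matrix.map_apply, Matrix.neg_apply, Finset.sum_sub_distrib, neg_mul, Finset.sum_neg_distrib,
      Sum.elim_comp_inl, Sum.elim_comp_inr]
    ring
  · simp only [reImVec_inr, Sum.elim_inr, Matrix.mulVec, dotProduct, Complex.im_sum, Complex.mul_im, Pi.add_apply,
      Matrix.map_apply, Finset.sum_add_distrib, Sum.elim_comp_inl, Sum.elim_comp_inr]
    ring

omit [Fintype ι] in
/-- `resMat 1 = 1`. [cite: Folland1989, Ch. 4 §1 Prop. (4.6)] -/
theorem resMat_one : resMat ι (1 : Matrix ι ι ℂ) = 1 := by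
  have h1 : (1 : Matrix ι ι ℂ).map Complex.re = 1 := Matrix.map_one _ (by simp) (by simp)
  have h2 : (1 : Matrix ι ι ℂ).map Complex.im = 0 := by
    ext i j
    rw [Matrix.map_apply, Matrix.one_apply, Matrix.zero_apply]
    split_ifs <;> simp
  rw [resMat, h1, h2, neg_zero, Matrix.fromBlocks_one]

omit [Fintype ι] [DecidableEq ι] in
/-- `resMat 0 = 0`. [cite: Folland1989, Ch. 4 §1 Prop. (4.6)] -/
theorem resMat_zero : resMat ι (0 : Matrix ι ι ℂ) = 0 := by
  ext (i | i) (j | j) <;> simp [resMat]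

omit [Fintype ι] [DecidableEq ι] in
/-- `resMat (M + N) = resMat M + resMat N`. [cite: Folland1989, Ch. 4 §1 Prop. (4.6)] -/
theorem resMat_add (M N : Matrix ι ι ℂ) : resMat ι (M + N) = resMat ι M + resMat ι N := by
  ext (i | i) (j | j) <;> simp [resMat, add_comm]

omit [DecidableEq ι] in
/-- `resMat (M N) = resMat M · resMat N`. [cite: Folland1989, Ch. 4 §1 Prop. (4.6)] -/
theorem resMat_mul (M N : Matrix ι ι ℂ) : resMat ι (M * N) = resMat ι M * resMat ι N := by
  rw [resMat, resMat, resMat, Matrix.fromBlocks_multiply]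
  congr 1 <;> ext i j <;>
    simp only [Matrix.map_apply, Matrix.mul_apply, Matrix.neg_apply, Matrix.add_apply, Matrix.neg_mul,
      Matrix.mul_neg, Complex.re_sum, Complex.im_sum, Complex.mul_re, Complex.mul_im, Finset.sum_sub_distrib,
      Finset.sum_add_distrib] <;> ring

omit [Fintype ι] [DecidableEq ι] in
/-- **`resMat Mᴴ = (resMat M)ᵀ`**: conjugate transpose realifies to transpose. [cite: Folland1989, Ch. 4 §1 Prop. (4.6)] -/
theorem resMat_conjTranspose (M : Matrix ι ι ℂ) : resMat ι Mᴴ = (resMat ι M)ᵀ := by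
  ext (i | i) (j | j) <;> simp [resMat]

variable (ι) in
/-- `resMat` as a ring homomorphism `M_ι(ℂ) →+* M_{ι ⊕ ι}(ℝ)`. [cite: Folland1989, Ch. 4 §1 Prop. (4.6)] -/
def resMatHom : Matrix ι ι ℂ →+* Matrix (ι ⊕ ι) (ι ⊕ ι) ℝ where
  toFun := resMat ι
  map_one' := resMat_one
  map_mul' := resMat_mul
  map_zero' := resMat_zero
  map_add' := resMat_add

/-- unfolding. [cite: Folland1989, Ch. 4 §1 Prop. (4.6)] -/
@[simp] theorem resMatHom_apply (M : Matrix ι ι ℂ) : resMatHom ι M = resMat ι M := rfl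

variable (ι) in
/-- **`resGL : GL_ι(ℂ) →* GL_{ι ⊕ ι}(ℝ)`**, realification of invertible matrices. [cite: Folland1989, Ch. 4 §1 Prop. (4.6)] -/
def resGL : GL ι ℂ →* GL (ι ⊕ ι) ℝ := Units.map (resMatHom ι).toMonoidHom

/-- underlying matrix. [cite: Folland1989, Ch. 4 §1 Prop. (4.6)] -/
@[simp] theorem coe_resGL (g : GL ι ℂ) : ((resGL ι g : GL (ι ⊕ ι) ℝ) : Matrix (ι ⊕ ι) (ι ⊕ ι) ℝ) = resMat ι g := rfl

/-- underlying matrix of the inverse. [cite: Folland1989, Ch. 4 §1 Prop. (4.6)] -/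
theorem coe_resGL_inv (g : GL ι ℂ) :
    (((resGL ι g)⁻¹ : GL (ι ⊕ ι) ℝ) : Matrix (ι ⊕ ι) (ι ⊕ ι) ℝ) = resMat ι ((g⁻¹ : GL ι ℂ) : Matrix ι ι ℂ) := by
  rw [← map_inv]; rfl

/-- **`(Res g)⁻ᵀ = Res ((g⁻¹)ᴴ) = Res (conj (g⁻ᵀ))`** — the contragredient realifies to the conjugate contragredient.
[cite: Folland1989, Ch. 4 §1 Prop. (4.6)] -/
theorem coe_trInv_resGL (g : GL ι ℂ) :
    ((trInv (resGL ι g) : GL (ι ⊕ ι) ℝ) : Matrix (ι ⊕ ι) (ι ⊕ ι) ℝ) = resMat ι ((g⁻¹ : GL ι ℂ) : Matrix ι ι ℂ)ᴴ := by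
  rw [coe_trInv, coe_resGL_inv, resMat_conjTranspose]

omit [Fintype ι] [DecidableEq ι] in
/-- `resMat` is continuous. [cite: Folland1989, Ch. 4 §1 Prop. (4.6)] -/
theorem continuous_resMat : Continuous (resMat ι) := by
  unfold resMat
  exact Continuous.matrix_fromBlocks (continuous_id.matrix_map Complex.continuous_re)
    ((continuous_id.matrix_map Complex.continuous_im).neg) (continuous_id.matrix_map Complex.continuous_im)
    (continuous_id.matrix_map Complex.continuous_re)

omit [Fintype ι] [DecidableEq ι] in
/-- `reImVec (conj ∘ z)` flips the sign of the imaginary block: `= (re z, -im z)`. [cite: Folland1989, Ch. 4 §1 Prop. (4.6)] -/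
theorem reImVec_conj (z : ι → ℂ) (k : ι ⊕ ι) :
    reImVec ι (fun j => conj (z j)) k = Sum.elim (fun j => (z j).re) (fun j => -(z j).im) k := by
  rcases k with j | j <;> simp [reImVec]

omit [DecidableEq ι] in
/-- `reImVec z ⬝ᵥ reImVec z' = re (Σ_j z_j conj(z'_j))`. [cite: Folland1989, Ch. 4 §1 Prop. (4.6)] -/
theorem reImVec_dotProduct (z z' : ι → ℂ) : reImVec ι z ⬝ᵥ reImVec ι z' = (∑ j, z j * conj (z' j)).re := by
  rw [dotProduct, Fintype.sum_sum_type, Complex.re_sum, ← Finset.sum_add_distrib]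
  refine Finset.sum_congr rfl fun j _ => ?_
  simp only [reImVec_inl, reImVec_inr, Complex.mul_re, Complex.conj_re, Complex.conj_im]
  ring

/-- **the complex Folland frame is Darboux for `-2 re B`**: `polar dotPairing (R_C x) (R_C y) = -2 re (polar β_{T_v} x y)`
(all `C_j ≠ 0`). [cite: Folland1989, Prop. (1.43)] -/
theorem polar_dotPairing_cxFollandScale (C : ι → ℂ) (hC : ∀ j, C j ≠ 0) (Tv : Matrix ι ι ℂ) (x y : (ι → ℂ) × (ι → ℂ)) :
    polar (dotPairing (ι ⊕ ι)) (cxFollandScale ι C Tv x) (cxFollandScale ι C Tv y) =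
      -2 * (polar (Matrix.toLinearMap₂' ℂ Tv) x y).re := by
  rw [polar_apply, dotPairing_apply, cxFollandScale_apply, cxFollandScale_apply, polar_apply,
    Matrix.toLinearMap₂'_apply', reImVec_dotProduct, dotProduct, ← Complex.re_ofReal_mul, Finset.mul_sum]
  congr 1
  refine Finset.sum_congr rfl fun j _ => ?_
  rw [map_mul, map_neg, Complex.conj_conj, map_ofNat, Complex.ofReal_neg, Complex.ofReal_ofNat]
  field_simp [hC j]

end Res

/-! ## §2 The complex Folland frame as a real-linear isomorphism; realification of `Sp_ℂ` -/

section Frame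

variable (C : ι → ℂ) (hC : ∀ j, C j ≠ 0) (Tv : Matrix ι ι ℂ) (hTvd : IsUnit Tv.det)

omit [DecidableEq ι] in
/-- the scalar identity behind the inverse frame: `-(C conj(-2 conj(t / C))) / 2 = t`. [cite: Folland1989, Prop. (1.43)] -/
private theorem frame_scalar_aux (c t : ℂ) (hc : c ≠ 0) : -(c * conj (-2 * conj (t / c))) / 2 = t := by
  rw [map_mul, map_neg, Complex.conj_conj, map_ofNat]
  field_simp

omit [DecidableEq ι] in
/-- and its companion: `-2 conj((-(C conj u) / 2) / C) = u`. [cite: Folland1989, Prop. (1.43)] -/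
private theorem frame_scalar_aux' (c u : ℂ) (hc : c ≠ 0) : -2 * conj (-(c * conj u) / 2 / c) = u := by
  have hc' : conj c ≠ 0 := (map_ne_zero _).mpr hc
  rw [map_div₀, map_div₀, map_neg, map_mul, Complex.conj_conj, map_ofNat]
  field_simp

include hC hTvd

/-- **`cxFrameEquiv C T_v : (ℂ^ι)² ≃ₗ[ℝ] (ℝ^{ι⊕ι})²`**, with `⇑ = cxFollandScale C T_v`,
`(a, w) ↦ (reImVec (C a), reImVec (-2 conj(T_v w / C)))`. [cite: Folland1989, Prop. (1.43)] -/
def cxFrameEquiv : ((ι → ℂ) × (ι → ℂ)) ≃ₗ[ℝ] ((ι ⊕ ι → ℝ) × (ι ⊕ ι → ℝ)) where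
  toFun := cxFollandScale ι C Tv
  invFun pq := (fun j => (C j)⁻¹ * ofReImVec ι pq.1 j, Tv⁻¹ *ᵥ fun j => -(C j * conj (ofReImVec ι pq.2 j)) / 2)
  map_add' x y := by
    have h1 : (fun j => C j * (x + y).1 j) = (fun j => C j * x.1 j) + fun j => C j * y.1 j := by
      funext j; simp only [Prod.fst_add, Pi.add_apply, mul_add]
    have h2 : (fun j => -2 * conj ((Tv *ᵥ (x + y).2) j / C j)) =
        (fun j => -2 * conj ((Tv *ᵥ x.2) j / C j)) + fun j => -2 * conj ((Tv *ᵥ y.2) j / C j) := by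
      funext j; simp only [Prod.snd_add, Matrix.mulVec_add, Pi.add_apply, add_div, map_add, mul_add]
    show cxFollandScale ι C Tv (x + y) = cxFollandScale ι C Tv x + cxFollandScale ι C Tv y
    rw [cxFollandScale_apply, cxFollandScale_apply, cxFollandScale_apply, h1, h2, reImVec_add, reImVec_add]
    rfl
  map_smul' r x := by
    have h1 : (fun j => C j * (r • x).1 j) = r • fun j => C j * x.1 j := by
      funext j; simp only [Prod.smul_fst, Pi.smul_apply, Complex.real_smul]; ring
    have h2 : (fun j => -2 * conj ((Tv *ᵥ (r • x).2) j / C j)) = r • fun j => -2 * conj ((Tv *ᵥ x.2) j / C j) := by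
      funext j
      simp only [Prod.smul_snd, Matrix.mulVec_smul, Pi.smul_apply, Complex.real_smul]
      rw [mul_div_assoc, map_mul, Complex.conj_ofReal]
      ring
    show cxFollandScale ι C Tv (r • x) = r • cxFollandScale ι C Tv x
    rw [cxFollandScale_apply, cxFollandScale_apply, h1, h2, reImVec_smul, reImVec_smul]
    rfl
  left_inv x := by
    obtain ⟨a, w⟩ := x
    rw [cxFollandScale_apply]
    simp only [ofReImVec_reImVec]
    refine Prod.ext (funext fun j => ?_) ?_
    · show (C j)⁻¹ * (C j * a j) = a j
      rw [← mul_assoc, inv_mul_cancel₀ (hC j), one_mul]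
    · show Tv⁻¹ *ᵥ (fun j => -(C j * conj (-2 * conj ((Tv *ᵥ w) j / C j))) / 2) = w
      have h : (fun j => -(C j * conj (-2 * conj ((Tv *ᵥ w) j / C j))) / 2) = Tv *ᵥ w :=
        funext fun j => frame_scalar_aux (C j) _ (hC j)
      rw [h, Matrix.mulVec_mulVec, Matrix.nonsing_inv_mul Tv hTvd, Matrix.one_mulVec]
  right_inv pq := by
    obtain ⟨p, q⟩ := pq
    rw [cxFollandScale_apply]
    refine Prod.ext ?_ ?_
    · show reImVec ι (fun j => C j * ((C j)⁻¹ * ofReImVec ι p j)) = p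
      have h : (fun j => C j * ((C j)⁻¹ * ofReImVec ι p j)) = ofReImVec ι p :=
        funext fun j => by rw [← mul_assoc, mul_inv_cancel₀ (hC j), one_mul]
      rw [h, reImVec_ofReImVec]
    · show reImVec ι (fun j => -2 * conj ((Tv *ᵥ (Tv⁻¹ *ᵥ fun j => -(C j * conj (ofReImVec ι q j)) / 2)) j / C j)) = q
      rw [Matrix.mulVec_mulVec, Matrix.mul_nonsing_inv Tv hTvd, Matrix.one_mulVec]
      have h : (fun j => -2 * conj (-(C j * conj (ofReImVec ι q j)) / 2 / C j)) = ofReImVec ι q :=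
        funext fun j => frame_scalar_aux' (C j) _ (hC j)
      rw [h, reImVec_ofReImVec]

/-- `⇑(cxFrameEquiv C T_v) = cxFollandScale C T_v`. [cite: Folland1989, Prop. (1.43)] -/
@[simp] theorem coe_cxFrameEquiv : ⇑(cxFrameEquiv C hC Tv hTvd) = cxFollandScale ι C Tv := rfl

/-- **`cxRealify C T_v M = R_C ∘ M ∘ R_C⁻¹ ∈ Sp((ℝ^{ι⊕ι})²)`** for `M ∈ Sp_ℂ((ℂ^ι)², polar β_{T_v})`: a complex
symplectic automorphism preserves `re B`, hence the standard real form in the Darboux frame `R_C`.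
[cite: MoeglinVignerasWaldspurger1987, Chap. 2 II.2] -/
def cxRealify (M : symplecticGroup (polar (Matrix.toLinearMap₂' ℂ Tv))) : symplecticGroup (polar (dotPairing (ι ⊕ ι))) :=
  ⟨(cxFrameEquiv C hC Tv hTvd).symm ≪≫ₗ ((M : ((ι → ℂ) × (ι → ℂ)) ≃ₗ[ℂ] ((ι → ℂ) × (ι → ℂ))).restrictScalars ℝ) ≪≫ₗ
      cxFrameEquiv C hC Tv hTvd, by
    rw [mem_symplecticGroup]
    intro P Q
    obtain ⟨x, rfl⟩ := (cxFrameEquiv C hC Tv hTvd).surjective P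
    obtain ⟨y, rfl⟩ := (cxFrameEquiv C hC Tv hTvd).surjective Q
    have hM := (mem_symplecticGroup _ _).mp M.2 x y
    simp only [LinearEquiv.trans_apply, LinearEquiv.symm_apply_apply, LinearEquiv.restrictScalars_apply]
    show polar _ (cxFollandScale ι C Tv _) (cxFollandScale ι C Tv _) - polar _ (cxFollandScale ι C Tv _) (cxFollandScale ι C Tv _) =
      polar _ (cxFollandScale ι C Tv x) (cxFollandScale ι C Tv y) - polar _ (cxFollandScale ι C Tv y) (cxFollandScale ι C Tv x)
    rw [polar_dotPairing_cxFollandScale C hC, polar_dotPairing_cxFollandScale C hC,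
      polar_dotPairing_cxFollandScale C hC, polar_dotPairing_cxFollandScale C hC, ← mul_sub, ← mul_sub,
      ← Complex.sub_re, ← Complex.sub_re]
    exact congrArg (fun t : ℂ => -2 * t.re) hM⟩

/-- `cxRealify` on vectors: `R_C (M (R_C⁻¹ pq))`. [cite: MoeglinVignerasWaldspurger1987, Chap. 2 II.2] -/
theorem coe_cxRealify_apply (M : symplecticGroup (polar (Matrix.toLinearMap₂' ℂ Tv)))
    (pq : (ι ⊕ ι → ℝ) × (ι ⊕ ι → ℝ)) :
    ((cxRealify C hC Tv hTvd M : symplecticGroup (polar (dotPairing (ι ⊕ ι)))) :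
        ((ι ⊕ ι → ℝ) × (ι ⊕ ι → ℝ)) ≃ₗ[ℝ] ((ι ⊕ ι → ℝ) × (ι ⊕ ι → ℝ))) pq =
      cxFollandScale ι C Tv ((M : ((ι → ℂ) × (ι → ℂ)) ≃ₗ[ℂ] ((ι → ℂ) × (ι → ℂ))) ((cxFrameEquiv C hC Tv hTvd).symm pq)) :=
  rfl

/-- **`cxRealify M (R_C x) = R_C (M x)`**. [cite: MoeglinVignerasWaldspurger1987, Chap. 2 II.2] -/
theorem cxRealify_apply_cxFollandScale (M : symplecticGroup (polar (Matrix.toLinearMap₂' ℂ Tv)))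
    (x : (ι → ℂ) × (ι → ℂ)) :
    ((cxRealify C hC Tv hTvd M : symplecticGroup (polar (dotPairing (ι ⊕ ι)))) :
        ((ι ⊕ ι → ℝ) × (ι ⊕ ι → ℝ)) ≃ₗ[ℝ] ((ι ⊕ ι → ℝ) × (ι ⊕ ι → ℝ))) (cxFollandScale ι C Tv x) =
      cxFollandScale ι C Tv ((M : ((ι → ℂ) × (ι → ℂ)) ≃ₗ[ℂ] ((ι → ℂ) × (ι → ℂ))) x) := by
  rw [coe_cxRealify_apply, ← coe_cxFrameEquiv C hC Tv hTvd, LinearEquiv.symm_apply_apply]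

/-- **`cxRealify` is a group homomorphism `Sp_ℂ((ℂ^ι)², polar β_{T_v}) →* Sp((ℝ^{ι⊕ι})²)`.**
[cite: MoeglinVignerasWaldspurger1987, Chap. 2 II.2] -/
def cxRealifyHom : symplecticGroup (polar (Matrix.toLinearMap₂' ℂ Tv)) →* symplecticGroup (polar (dotPairing (ι ⊕ ι))) where
  toFun := cxRealify C hC Tv hTvd
  map_one' := Subtype.ext (LinearEquiv.ext fun pq => by
    rw [coe_cxRealify_apply, Subgroup.coe_one, LinearEquiv.coe_one, id, ← coe_cxFrameEquiv C hC Tv hTvd,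
      LinearEquiv.apply_symm_apply, Subgroup.coe_one, LinearEquiv.coe_one, id])
  map_mul' M N := Subtype.ext (LinearEquiv.ext fun pq => by
    rw [Subgroup.coe_mul, LinearEquiv.mul_apply, coe_cxRealify_apply, coe_cxRealify_apply, coe_cxRealify_apply,
      ← coe_cxFrameEquiv C hC Tv hTvd, LinearEquiv.symm_apply_apply, Subgroup.coe_mul, LinearEquiv.mul_apply])

/-- unfolding. [cite: MoeglinVignerasWaldspurger1987, Chap. 2 II.2] -/
@[simp] theorem cxRealifyHom_apply (M : symplecticGroup (polar (Matrix.toLinearMap₂' ℂ Tv))) :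
    cxRealifyHom C hC Tv hTvd M = cxRealify C hC Tv hTvd M := rfl

end Frame

/-! ## §3 The complex Siegel Levi realifies to the real Siegel Levi (`C = 1`) -/

section Levi

variable (Tv : Matrix ι ι ℂ) (hTvd : IsUnit Tv.det)

omit [Fintype ι] [DecidableEq ι] in
/-- the trivial scaling `C = 1` does not vanish. [cite: Folland1989, Prop. (1.43)] -/
theorem one_scale_ne_zero : ∀ j : ι, (fun _ : ι => (1 : ℂ)) j ≠ 0 := fun _ => one_ne_zero

omit [DecidableEq ι] in
/-- with `C = 1` the first frame coordinate is plain realification: `(R_1 (a, w)).1 = reImVec a`.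
[cite: Folland1989, Prop. (1.43)] -/
theorem cxFollandScale_one_fst (x : (ι → ℂ) × (ι → ℂ)) : (cxFollandScale ι (fun _ => (1 : ℂ)) Tv x).1 = reImVec ι x.1 := by
  rw [cxFollandScale_apply]
  exact congrArg (reImVec ι) (funext fun j => one_mul _)

omit [DecidableEq ι] in
/-- with `C = 1` the second frame coordinate is `reImVec (-2 conj (T_v w))`. [cite: Folland1989, Prop. (1.43)] -/
theorem cxFollandScale_one_snd (x : (ι → ℂ) × (ι → ℂ)) :
    (cxFollandScale ι (fun _ => (1 : ℂ)) Tv x).2 = reImVec ι (fun j => -2 * conj ((Tv *ᵥ x.2) j)) := by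
  rw [cxFollandScale_apply]
  exact congrArg (reImVec ι) (funext fun j => by rw [div_one])

omit [DecidableEq ι] in
/-- `-2 conj (M v) = (conj M) (-2 conj v)` entrywise. [cite: Folland1989, Ch. 4 §1 Prop. (4.6)] -/
theorem neg_two_mul_conj_mulVec (M : Matrix ι ι ℂ) (v : ι → ℂ) :
    (fun j => -2 * conj ((M *ᵥ v) j)) = M.map (starRingEnd ℂ) *ᵥ fun j => -2 * conj (v j) := by
  funext j
  rw [RingHom.map_mulVec (starRingEnd ℂ) M v j]
  simp only [Matrix.mulVec, dotProduct, Function.comp_apply, Matrix.map_apply, Finset.mul_sum]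
  exact Finset.sum_congr rfl fun i _ => by ring

/-- **THE COMPLEX SIEGEL LEVI REALIFIES TO THE REAL SIEGEL LEVI**: for `g₊ ∈ GL_ι(ℂ)`,
`cxRealify 1 T_v (m(g₊, T_v⁻¹ g₊⁻ᵀ T_v)) = m(Res g₊, (Res g₊)⁻ᵀ)` — the projection of `MpS.leviGL (resGL g₊)`.
[cite: Folland1989, §4.2 (4.24); MoeglinVignerasWaldspurger1987, Chap. 2 II.2] -/
theorem cxRealify_leviSp (g : GL ι ℂ) :
    cxRealify (fun _ => (1 : ℂ)) one_scale_ne_zero Tv hTvd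
        (leviSp (Matrix.toLinearMap₂' ℂ Tv) (glEquiv g) (leviDual Tv hTvd g) (leviDual_compat Tv hTvd g)) =
      leviSp (dotPairing (ι ⊕ ι)) (glEquiv (resGL ι g)) (glEquiv (trInv (resGL ι g)))
        (dotPairing_glEquiv_trInv (resGL ι g)) := by
  apply Subtype.ext
  apply LinearEquiv.ext
  intro pq
  obtain ⟨⟨a, w⟩, rfl⟩ := (cxFrameEquiv (fun _ => (1 : ℂ)) one_scale_ne_zero Tv hTvd).surjective pq
  rw [coe_cxFrameEquiv, cxRealify_apply_cxFollandScale, coe_leviSp_apply, coe_leviSp_apply, glEquiv_apply,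
    leviDual_apply, glEquiv_apply, glEquiv_apply, coe_resGL, coe_trInv_resGL]
  refine Prod.ext ?_ ?_
  · rw [cxFollandScale_one_fst, cxFollandScale_one_fst, reImVec_mulVec]
  · rw [cxFollandScale_one_snd, cxFollandScale_one_snd, Matrix.mulVec_mulVec, Matrix.mul_assoc,
      Matrix.mul_nonsing_inv_cancel_left Tv _ hTvd, ← Matrix.mulVec_mulVec, neg_two_mul_conj_mulVec, reImVec_mulVec]
    rfl

end Levi

/-! ## §4 A unitary group `U(swap, T_v ⊗ 1)(ℂ × ℂ)` realifies to a conjugate of the real Siegel Levi -/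

section Unitary

variable (Tv : Matrix ι ι ℂ) (hTvd : IsUnit Tv.det)

omit [Fintype ι] [DecidableEq ι] in
/-- `2 s · (2s)⁻¹ = 1` in `ℂ` (field-generic `mul_inv_cancel₀`, recorded for the Cayley parameter `e = (2s)⁻¹`).
[cite: MoeglinVignerasWaldspurger1987, Chap. 1 I.17] -/
theorem two_mul_mul_inv_two_mul_complex {s : ℂ} (hs : s ≠ 0) : 2 * s * (2 * s)⁻¹ = 1 :=
  mul_inv_cancel₀ (mul_ne_zero two_ne_zero hs)

/-- **the realified split Cayley element** `κ = cxRealify 1 T_v (splitCayley)` of `Sp((ℝ^{ι⊕ι})²)`.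
[cite: MoeglinVignerasWaldspurger1987, Chap. 2 III.1] -/
def cxCayley {s : ℂ} (hs : s ≠ 0) (hTv : Tv.IsSymm) : symplecticGroup (polar (dotPairing (ι ⊕ ι))) :=
  cxRealify (fun _ => (1 : ℂ)) one_scale_ne_zero Tv hTvd
    (IsQuadraticCoordinates.splitCayley ι Tv (two_mul_mul_inv_two_mul_complex hs) hTv)

/-- **`U(swap, T_v ⊗ 1)(ℂ × ℂ)` REALIFIES TO A CONJUGATE OF THE REAL SIEGEL LEVI**: for `g ∈ U(swap, T_v ⊗ 1)`,
`cxRealify 1 T_v (toSymplectic g) = κ⁻¹ · m(Res g₊, (Res g₊)⁻ᵀ) · κ` with `κ = cxCayley` and `g₊ = plusGL g`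
(`UnitaryGroupSymplecticSplitLevi.splitCayley_conj_toSymplectic` realified by §2–§3).
[cite: Kudla1994, §3; MoeglinVignerasWaldspurger1987, Chap. 2 II.2] -/
theorem cxRealify_toSymplectic {s : ℂ} (hs : s ≠ 0) (hTv : Tv.IsSymm) {H : Matrix ι ι (ℂ × ℂ)}
    (hH : H = Tv.map ((RingHom.id ℂ).prod (RingHom.id ℂ)))
    (g : unitaryGroupOfForm (RingEquiv.prodComm : ℂ × ℂ ≃+* ℂ × ℂ).toRingHom H) :
    cxRealify (fun _ => (1 : ℂ)) one_scale_ne_zero Tv hTvd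
        ((isQuadraticCoordinates_splitPair s hs).toSymplectic ι hTv (swap_pair_diag (K := ℂ)) (swap_pair_delta s) hH g) =
      (cxCayley Tv hTvd hs hTv)⁻¹ *
        leviSp (dotPairing (ι ⊕ ι)) (glEquiv (resGL ι ((isQuadraticCoordinates_splitPair s hs).plusGL rfl ι g)))
          (glEquiv (trInv (resGL ι ((isQuadraticCoordinates_splitPair s hs).plusGL rfl ι g))))
          (dotPairing_glEquiv_trInv _) *
        cxCayley Tv hTvd hs hTv := by
  have key := (isQuadraticCoordinates_splitPair s hs).splitCayley_conj_toSymplectic rfl ι hTvd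
    (two_mul_mul_inv_two_mul_complex hs) (swap_pair_diag (K := ℂ)) (swap_pair_delta s) hH hTv g
  have h1 : (isQuadraticCoordinates_splitPair s hs).toSymplectic ι hTv (swap_pair_diag (K := ℂ)) (swap_pair_delta s) hH g =
      (IsQuadraticCoordinates.splitCayley ι Tv (two_mul_mul_inv_two_mul_complex hs) hTv)⁻¹ *
        leviSp (Matrix.toLinearMap₂' ℂ Tv) (glEquiv ((isQuadraticCoordinates_splitPair s hs).plusGL rfl ι g))
          (leviDual Tv hTvd ((isQuadraticCoordinates_splitPair s hs).plusGL rfl ι g))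
          (leviDual_compat Tv hTvd _) *
        IsQuadraticCoordinates.splitCayley ι Tv (two_mul_mul_inv_two_mul_complex hs) hTv := by
    rw [← key]; group
  rw [h1, ← cxRealifyHom_apply, map_mul, map_mul, map_inv, cxRealifyHom_apply, cxRealifyHom_apply,
    cxRealify_leviSp]
  rfl

end Unitary

end Literature.NumberTheory.Weil1964

end
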